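import Summits.BirchSwinnertonDyer.Rank1Residual.Additive.X3BranchResidualLineH1LowerBound
import Literature.NumberTheory.EllipticCurves.DeligneSerreWeightOneIrreducibleKroneckerWeberProofs
import Literature.NumberTheory.GaloisRepresentations.GaloisCohomologyKummerProofs
import HarnessLib

/-!
# X3, the DEGENERATE rows: KUMMER classes with values in an `ω`-line — the cocycle of a `p`-th
# root, its class in `H¹(G_{ℚ_∞}, Ψ)`, conjugation-invariance, local vanishing, and injectivity
# (a class trivial on `G_{ℚ_∞}` comes from a `p`-th power in `ℚ`)
# (cell `bsd-eis`, seat `bsd-eis-x3` gen 6; toolkit for the LOWER BOUND on GV's `U(W[p]/Φ₀)` of the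
# degenerate certificate road `X3BranchDegenerateEndStateCardGe.lean`; route K1
# `AdditiveBranchIMC`, crux `GordTwoRankZeroOffCaseOne` — supports only)

HONEST FRAMING (cell `bsd-eis`, `run/shared/lean/pub/bsd-eis/README.md` §4): the programme's target of
record is the full Birch–Swinnerton-Dyer formula for every `E/ℚ` of analytic rank `≤ 1`; this file is
pure Galois-cohomological tooling for the DEGENERATE X3 rows (where `Ψ = W[p]/Φ₀` carries the
mod-`p` cyclotomic character `ω`). THEOREMS ONLY (no `def`, no named fact, no `sorry`); nothing is
booked; no label, tier or count of record moves.

## What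

For a discrete `Γ_ℚ`-module `Ψ` on which `σ` acts as the scalar `χ_p(σ)` (an "`ω`-line"), a
primitive `p`-th root of unity `ζ ∈ ℚ̄` and `β ∈ ℚ̄` with `β^p = a ∈ ℚˣ`:
* §1 `exists_kummerCocycle` — the continuous crossed homomorphism `f(σ) = n_σ·y₀`
  (`σβ = ζ^{n_σ}β`), i.e. the Kummer cocycle of `a` pushed along `μ_p ≅ Ψ`, `ζ ↦ y₀`
  (`exists_smul_eq_pow_mul`, `natCast_eq_of_pow_mul_eq`, `isLocallyConstant_smul`);
* §2 for ANY continuous crossed homomorphism `f : Γ_ℚ → Ψ` and normal `H ≤ Γ_ℚ`: the class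
  `[f|_H]` (`exists_class_of_cocycle`), `conj_τ [f|_H] = [f|_H]` (`conjH1_eq_self_of_cocycle`:
  `(τ·f)(h) − f(h) = ∂(f(τ))(h)`), and membership in `unramifiedKer` / GV's `unramifiedSelmer` from
  POINTWISE vanishing of `f` on the relevant inertia groups (`mem_unramified{Ker,Selmer}_of_cocycle`);
* §3 injectivity: if `f|_H = ∂(t·y₀)` then `ζ^{−t}β` is `H`-fixed (`exists_fixed_root_of_coboundary`);
  an element `γ` with `γ^p ∈ ℚˣ` fixed by `G_{ℚ_∞} = ker κ` is RATIONAL (`exists_ratCast_eq_of_fixed`),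
  because `χ_p` cannot die on `ker κ` (`not_kerSubgroup_le_ker_cyclotomic`: `Γ_ℚ/ker κ ≅ ℤ_p` is
  `(p−1)`-divisible, `𝔽_pˣ` has exponent `p − 1`, and `χ_p(Γ_ℚ) ∋ −1 ≠ 1` for odd `p`).

References: [SerreLocalFields1979] Ch. X §3 (Kummer theory), Ch. VII §5 Prop. 3;
[SerreGaloisCohomology1997] I.§2, II.§1.2; [GreenbergVatsal2000] §2 pp. 28–29; cell files
`run/shared/lean/pub/bsd-eis/x3-MEMO-{2,3}.md` (D3).
-/

set_option autoImplicit false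

noncomputable section

open scoped Classical AddSubgroup

namespace Summit.BirchSwinnertonDyer.Rank1Residual.Additive

namespace KummerLineClasses

open NumberField IsDedekindDomain Field WeierstrassCurve
  Literature.NumberTheory.GaloisRepresentations
  Literature.NumberTheory.EllipticCurves
  Literature.NumberTheory.EllipticCurves.GreenbergSelmer
  Literature.NumberTheory.EllipticCurves.GreenbergVatsal2000
  Literature.NumberTheory.EllipticCurves.Rank1Residual

variable {p : ℕ} [hp : Fact p.Prime]
  {Ψ : Type} [AddCommGroup Ψ] [DistribMulAction (absoluteGaloisGroup ℚ) Ψ]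
  [TopologicalSpace Ψ] [DiscreteTopology Ψ]

/-! ### §1 The Kummer cocycle of a `p`-th root into an `ω`-line -/

/-- **The exponent of a `p`-th root.** `ζ` a primitive `p`-th root of unity in `ℚ̄`, `β ∈ ℚ̄` with
`β^p = a ∈ ℚˣ`: for every `σ ∈ Γ_ℚ` there is `n < p` with `σ β = ζ^n β`. [folklore] -/
theorem exists_smul_eq_pow_mul {ζ : AlgebraicClosure ℚ} (hζ : IsPrimitiveRoot ζ p) {a : ℚ}
    (ha : a ≠ 0) {β : AlgebraicClosure ℚ} (hβ : β ^ p = (a : AlgebraicClosure ℚ))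
    (σ : absoluteGaloisGroup ℚ) : ∃ n : ℕ, n < p ∧ σ • β = ζ ^ n * β := by
  have hβ0 : β ≠ 0 := by
    rintro rfl
    rw [zero_pow hp.out.ne_zero, eq_comm, Rat.cast_eq_zero] at hβ
    exact ha hβ
  have hq : (σ • β / β) ^ p = 1 := by
    rw [div_pow, ← smul_pow', hβ, absoluteGaloisGroup.smul_def, map_ratCast, div_self]
    exact_mod_cast ha
  obtain ⟨n, hn, hζn⟩ := hζ.eq_pow_of_pow_eq_one hq
  exact ⟨n, hn, by rw [hζn, div_mul_cancel₀ _ hβ0]⟩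

/-- Uniqueness of the exponent modulo `p`: `ζ^n β = ζ^m β ⇒ n ≡ m (mod p)`. [folklore] -/
theorem natCast_eq_of_pow_mul_eq {ζ : AlgebraicClosure ℚ} (hζ : IsPrimitiveRoot ζ p)
    {β : AlgebraicClosure ℚ} (hβ0 : β ≠ 0) {n m : ℕ} (h : ζ ^ n * β = ζ ^ m * β) :
    (n : ZMod p) = m := by
  have h' : ζ ^ n = ζ ^ m := mul_right_cancel₀ hβ0 h
  have hp0 : 0 < p := hp.out.pos
  rw [← pow_mod_orderOf ζ n, ← pow_mod_orderOf ζ m, ← hζ.eq_orderOf] at h'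
  have hnm : n % p = m % p := hζ.pow_inj (Nat.mod_lt _ hp0) (Nat.mod_lt _ hp0) h'
  exact (ZMod.natCast_eq_natCast_iff' n m p).mpr hnm

/-- The orbit map `σ ↦ σ • β` (`β ∈ ℚ̄`) is locally constant on `Γ_ℚ`. [folklore] -/
theorem isLocallyConstant_smul (β : AlgebraicClosure ℚ) :
    IsLocallyConstant fun σ : absoluteGaloisGroup ℚ ↦ σ • β := by
  by_cases hβ : β = 0
  · subst hβ
    simp_rw [smul_zero]
    exact IsLocallyConstant.const 0
  · have h := isLocallyConstant_smul_units ℚ (Units.mk0 β hβ)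
    have h' := h.comp (fun u : (AlgebraicClosure ℚ)ˣ ↦ (u : AlgebraicClosure ℚ))
    convert h' using 1
    funext σ
    simp

omit [DiscreteTopology Ψ] in
/-- **The Kummer cocycle of a `p`-th root with values in an `ω`-LINE.** `Ψ` a discrete
`Γ_ℚ`-module on which `σ` acts as the scalar `χ_p(σ)` (`χ_p` the mod-`p` cyclotomic character),
`y₀ ∈ Ψ` with `p·y₀ = 0`, `ζ ∈ ℚ̄` a primitive `p`-th root of unity, `β ∈ ℚ̄` with `β^p = a ∈ ℚˣ`.
Then `f(σ) = n_σ·y₀`, where `σβ = ζ^{n_σ}β`, is a continuous crossed homomorphism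
`Γ_ℚ → Ψ` (`f(στ) = f(σ) + σ·f(τ)`, because `σζ = ζ^{χ_p(σ)}`) — the Kummer cocycle of `a`
transported along `μ_p ≅ Ψ`, `ζ ↦ y₀`. Stated as an existence (no definition).
[cite: SerreLocalFields1979, Ch. X §3 (Kummer theory)] -/
theorem exists_kummerCocycle [NeZero ((p : ℕ) : ℚ)]
    (hΨ : ∀ (σ : absoluteGaloisGroup ℚ) (y : Ψ),
      σ • y = ((modNCyclotomicCharacter ℚ p σ : (ZMod p)ˣ) : ZMod p).val • y)
    (y₀ : Ψ) (hy₀ : p • y₀ = 0) {ζ : AlgebraicClosure ℚ} (hζ : IsPrimitiveRoot ζ p) {a : ℚ}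
    (ha : a ≠ 0) {β : AlgebraicClosure ℚ} (hβ : β ^ p = (a : AlgebraicClosure ℚ)) :
    ∃ f : absoluteGaloisGroup ℚ → Ψ, Continuous f ∧ (∀ σ τ, f (σ * τ) = f σ + σ • f τ) ∧
      ∀ σ, ∃ n : ℕ, σ • β = ζ ^ n * β ∧ f σ = n • y₀ := by
  haveI : NeZero p := ⟨hp.out.ne_zero⟩
  have hβ0 : β ≠ 0 := by
    rintro rfl
    rw [zero_pow hp.out.ne_zero, eq_comm, Rat.cast_eq_zero] at hβ
    exact ha hβ
  -- the exponent as a function of the conjugate `x = σβ`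
  let nOf : AlgebraicClosure ℚ → ℕ := fun x ↦
    if h : ∃ n : ℕ, n < p ∧ x = ζ ^ n * β then Classical.choose h else 0
  have hnOf : ∀ σ : absoluteGaloisGroup ℚ, σ • β = ζ ^ nOf (σ • β) * β := fun σ ↦ by
    have h : ∃ n : ℕ, n < p ∧ σ • β = ζ ^ n * β := by
      obtain ⟨n, hn, h⟩ := exists_smul_eq_pow_mul hζ ha hβ σ; exact ⟨n, hn, h⟩
    simp only [nOf, dif_pos h]
    exact (Classical.choose_spec h).2
  -- `p`-torsion bookkeeping
  have hmod : ∀ n m : ℕ, (n : ZMod p) = m → n • y₀ = m • y₀ := fun n m h ↦ by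
    rw [nsmul_eq_mod_nsmul n hy₀, nsmul_eq_mod_nsmul m hy₀, (ZMod.natCast_eq_natCast_iff' n m p).mp h]
  have hζp : ζ ^ p = 1 := hζ.pow_eq_one
  refine ⟨fun σ ↦ nOf (σ • β) • y₀, ?_, fun σ τ ↦ ?_, fun σ ↦ ⟨nOf (σ • β), hnOf σ, rfl⟩⟩
  · -- continuity: locally constant through the orbit map
    exact ((isLocallyConstant_smul β).comp (fun x ↦ nOf x • y₀)).continuous
  · -- the cocycle identity from `σζ = ζ^{χ_p(σ)}`
    set nσ := nOf (σ • β) with hnσ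
    set nτ := nOf (τ • β) with hnτ
    set nστ := nOf ((σ * τ) • β) with hnστ
    have hσ' : σ • β = ζ ^ nσ * β := hnOf σ
    have hτ' : τ • β = ζ ^ nτ * β := hnOf τ
    have hστ' : (σ * τ) • β = ζ ^ nστ * β := hnOf (σ * τ)
    have h1 : (σ * τ) • β =
        ζ ^ (nσ + ((modNCyclotomicCharacter ℚ p σ : (ZMod p)ˣ) : ZMod p).val * nτ) * β := by
      rw [mul_smul, hτ', smul_mul', smul_pow', modNCyclotomicCharacter_spec ℚ p σ ζ hζp, hσ',
        ← pow_mul, ← mul_assoc, ← pow_add, add_comm]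
    rw [hστ'] at h1
    have h3 := natCast_eq_of_pow_mul_eq hζ hβ0 h1
    change nστ • y₀ = nσ • y₀ + σ • (nτ • y₀)
    rw [hmod _ _ h3, add_nsmul, smul_comm σ nτ y₀, hΨ σ y₀, ← mul_nsmul', mul_comm]

/-! ### §2 Classes in `H¹(H, Ψ)` of `Γ_ℚ`-cocycles: restriction, conjugation, local vanishing -/

section Classes

variable (H : Subgroup (absoluteGaloisGroup ℚ)) [H.Normal]

omit hp [H.Normal] in
/-- **The class `[f|_H] ∈ H¹(H, Ψ)` of a continuous crossed homomorphism `f : Γ_ℚ → Ψ`**, with its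
cocycle: an existence statement (no definition) recording a representative. [folklore] -/
theorem exists_class_of_cocycle (f : absoluteGaloisGroup ℚ → Ψ) (hc : Continuous f)
    (hf : ∀ σ τ, f (σ * τ) = f σ + σ • f τ) :
    ∃ (F : contOneCocycles (discreteTopRep H Ψ)) (c : subgroupH1 H Ψ),
      (∀ h : H, F.1 h = f h) ∧ c = oneCocycleClass (discreteTopRep H Ψ) F := by
  refine ⟨⟨⟨fun h : H ↦ f h, hc.comp continuous_subtype_val⟩, fun g h ↦ ?_⟩, _, fun h ↦ rfl, rfl⟩
  change f ((g : absoluteGaloisGroup ℚ) * h) = f g + (g : absoluteGaloisGroup ℚ) • f h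
  exact hf g h

omit hp in
/-- **Conjugation acts trivially on classes restricted from `Γ_ℚ`**: for a crossed homomorphism
`f` on `Γ_ℚ`, `conj_τ [f|_H] = [f|_H]` — `(τ·f)(h) − f(h) = h·f(τ) − f(τ)` is a coboundary.
[cite: SerreLocalFields1979, Ch. VII §5 Prop. 3] -/
theorem conjH1_eq_self_of_cocycle (f : absoluteGaloisGroup ℚ → Ψ)
    (hf : ∀ σ τ, f (σ * τ) = f σ + σ • f τ) (F : contOneCocycles (discreteTopRep H Ψ))
    (hF : ∀ h : H, F.1 h = f h) (τ : absoluteGaloisGroup ℚ) :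
    conjH1 H Ψ τ (oneCocycleClass (discreteTopRep H Ψ) F) =
      oneCocycleClass (discreteTopRep H Ψ) F := by
  have hf1 : f 1 = 0 := by
    have h := hf 1 1; rw [mul_one, one_smul] at h; exact left_eq_add.mp h
  have hfinv : τ • f τ⁻¹ = -f τ := by
    have h := hf τ τ⁻¹; rw [mul_inv_cancel, hf1] at h
    exact (neg_eq_of_add_eq_zero_right h.symm).symm
  change resH1Hom (subgroupConj H τ) (DistribSMul.toAddMonoidHom Ψ τ) _
    (oneCocycleClass (discreteTopRep H Ψ) F) = _
  unfold resH1Hom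
  change (ContinuousCohomology.map (subgroupConj H τ) _ 1).hom (oneCocycleClass (discreteTopRep H Ψ) F) = _
  rw [map_oneCocycleClass, ← sub_eq_zero, ← oneCocycleClass_sub, oneCocycleClass_eq_zero_iff]
  refine ⟨f τ, fun h ↦ ?_⟩
  change τ • F.1 (subgroupConj H τ h) - F.1 h = (h : absoluteGaloisGroup ℚ) • f τ - f τ
  rw [hF, hF, subgroupConj_apply_coe, hf, hf]
  simp only [smul_add, smul_smul, mul_inv_cancel_left, mul_inv_cancel, one_smul, hfinv]
  abel

omit hp [H.Normal] in
/-- **A cocycle vanishing on `I_v` gives a class unramified at `v`**: `[f|_H]` restricts to zero on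
`H ⊓ I_v` (`unramifiedKer`). [folklore] -/
theorem mem_unramifiedKer_of_cocycle (f : absoluteGaloisGroup ℚ → Ψ)
    (F : contOneCocycles (discreteTopRep H Ψ)) (hF : ∀ h : H, F.1 h = f h)
    (v : HeightOneSpectrum (𝓞 ℚ)) (hv : ∀ τ ∈ inertia v, f τ = 0) :
    oneCocycleClass (discreteTopRep H Ψ) F ∈ GreenbergVatsal2000.unramifiedKer H Ψ v := by
  rw [GreenbergVatsal2000.unramifiedKer, ← resKer_eq_ker, oneCocycleClass_mem_resKer_iff]
  refine ⟨0, fun x ↦ ?_⟩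
  rw [smul_zero, sub_zero, AddMonoidHom.id_apply, hF]
  exact hv _ ((mem_inertiaIn_iff H v x.1).1 x.2).2

omit hp in
/-- **A cocycle class in GV's `U`.** If the crossed homomorphism `f : Γ_ℚ → Ψ` vanishes on the
inertia group `I_v` of every finite `v ∉ S₀` (those above `p` INCLUDED), then `[f|_H]` lies in
`unramifiedSelmer H Ψ p S₀` (conjugation-invariance + local vanishing).
[cite: GreenbergVatsal2000, §2 pp. 28–29] -/
theorem mem_unramifiedSelmer_of_cocycle (f : absoluteGaloisGroup ℚ → Ψ)
    (hf : ∀ σ τ, f (σ * τ) = f σ + σ • f τ) (F : contOneCocycles (discreteTopRep H Ψ))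
    (hF : ∀ h : H, F.1 h = f h) (S₀ : Set (HeightOneSpectrum (𝓞 ℚ)))
    (hv : ∀ v : HeightOneSpectrum (𝓞 ℚ), v ∉ S₀ → ∀ τ ∈ inertia v, f τ = 0)
    (hvp : ∀ v : HeightOneSpectrum (𝓞 ℚ), ((p : ℕ) : 𝓞 ℚ) ∈ v.asIdeal → ∀ τ ∈ inertia v, f τ = 0) :
    oneCocycleClass (discreteTopRep H Ψ) F ∈ unramifiedSelmer H Ψ p S₀ := by
  refine AddSubgroup.mem_inf.mpr ⟨?_, ?_⟩
  · rw [mem_unramifiedOutside_iff]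
    intro v hvS _ σ
    rw [conjH1_eq_self_of_cocycle H f hf F hF σ]
    exact mem_unramifiedKer_of_cocycle H f F hF v (hv v hvS)
  · simp only [AddSubgroup.mem_iInf, AddSubgroup.mem_comap]
    intro v hvp' σ
    rw [conjH1_eq_self_of_cocycle H f hf F hF σ]
    exact mem_unramifiedKer_of_cocycle H f F hF v (hvp v hvp')

end Classes

/-! ### §3 Injectivity: a Kummer class trivial on `G_{ℚ_∞}` comes from a `p`-th power in `ℚ` -/

section Injective

/-- Powers of a primitive `p`-th root agree when the exponents agree mod `p`. [folklore] -/
theorem pow_eq_pow_of_natCast_eq {ζ : AlgebraicClosure ℚ} (hζ : IsPrimitiveRoot ζ p) {n m : ℕ}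
    (h : (n : ZMod p) = m) : ζ ^ n = ζ ^ m := by
  rw [← pow_mod_orderOf ζ n, ← pow_mod_orderOf ζ m, ← hζ.eq_orderOf,
    (ZMod.natCast_eq_natCast_iff' n m p).mp h]

omit [TopologicalSpace Ψ] [DiscreteTopology Ψ] in
/-- **A Kummer cocycle that is a coboundary on `H` has an `H`-fixed `p`-th root.** `Ψ` an `ω`-line
generated by `y₀` of order `p`; `f` a Kummer cocycle of `β` (`β^p = a`) in the sense
`σβ = ζ^{n_σ}β`, `f(σ) = n_σ y₀`. If `f|_H = ∂(t·y₀)` then `γ = ζ^{−t}β` is fixed by `H` (and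
`γ^p = a`). [cite: SerreLocalFields1979, Ch. X §3] -/
theorem exists_fixed_root_of_coboundary [NeZero ((p : ℕ) : ℚ)]
    (hΨ : ∀ (σ : absoluteGaloisGroup ℚ) (y : Ψ),
      σ • y = ((modNCyclotomicCharacter ℚ p σ : (ZMod p)ˣ) : ZMod p).val • y)
    {y₀ : Ψ} (hy₀ : addOrderOf y₀ = p) (hgen : ∀ y : Ψ, ∃ t : ℕ, y = t • y₀)
    {ζ : AlgebraicClosure ℚ} (hζ : IsPrimitiveRoot ζ p) {a : ℚ}
    {β : AlgebraicClosure ℚ} (hβ : β ^ p = (a : AlgebraicClosure ℚ))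
    {f : absoluteGaloisGroup ℚ → Ψ} (hf : ∀ σ, ∃ n : ℕ, σ • β = ζ ^ n * β ∧ f σ = n • y₀)
    (H : Subgroup (absoluteGaloisGroup ℚ)) {y : Ψ} (hcob : ∀ h ∈ H, f h = h • y - y) :
    ∃ γ : AlgebraicClosure ℚ, γ ^ p = (a : AlgebraicClosure ℚ) ∧ ∀ h ∈ H, h • γ = γ := by
  haveI : NeZero p := ⟨hp.out.ne_zero⟩
  obtain ⟨t, rfl⟩ := hgen y
  set s : ℕ := p - t % p with hs
  have hst : ((s + t : ℕ) : ZMod p) = 0 := by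
    have hlt : t % p < p := Nat.mod_lt _ hp.out.pos
    have hsum : s + t % p = p := by omega
    rw [Nat.cast_add, ← ZMod.natCast_mod t p, ← Nat.cast_add, hsum, ZMod.natCast_self]
  refine ⟨ζ ^ s * β, ?_, fun h hh ↦ ?_⟩
  · rw [mul_pow, ← pow_mul, mul_comm s, pow_mul, hζ.pow_eq_one, one_pow, one_mul, hβ]
  · obtain ⟨n, hn, hfn⟩ := hf h
    set χ : ℕ := ((modNCyclotomicCharacter ℚ p h : (ZMod p)ˣ) : ZMod p).val with hχ
    -- `n + t ≡ t χ (mod p)` from `f h = h•(t y₀) − t y₀`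
    have h1 : ((n + t : ℕ) : ZMod p) = (t * χ : ℕ) := by
      have e := hcob h hh
      rw [hfn, smul_comm, hΨ h y₀, ← hχ, ← mul_nsmul', eq_sub_iff_add_eq, ← add_nsmul] at e
      have e' := nsmul_inj_mod.mp e
      rw [hy₀] at e'
      exact (ZMod.natCast_eq_natCast_iff' _ _ p).mpr e'
    have h2 : ((χ * s + n : ℕ) : ZMod p) = s := by
      push_cast at h1 hst ⊢
      linear_combination h1 + ((χ : ZMod p) - 1) * hst
    rw [smul_mul', smul_pow', modNCyclotomicCharacter_spec ℚ p h ζ hζ.pow_eq_one, ← hχ, hn,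
      ← pow_mul, ← mul_assoc, ← pow_add, pow_eq_pow_of_natCast_eq hζ h2]

omit hp in
/-- **The mod-`p` cyclotomic character does not factor through a `ℤ_p`-extension** (`p` odd): if
`χ_p` is trivial on `ker κ` then it is trivial — `Γ_ℚ/ker κ ≅ ℤ_p` is `(p−1)`-divisible while
`𝔽_pˣ` has exponent `p − 1` — contradicting `χ_p(Γ_ℚ) = 𝔽_pˣ ≠ 1`. [folklore] -/
theorem not_kerSubgroup_le_ker_cyclotomic [Fact p.Prime] [NeZero ((p : ℕ) : ℚ)] (hp2 : p ≠ 2)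
    (κ : ZpExtension ℚ p) :
    ¬ ∀ h ∈ κ.kerSubgroup, modNCyclotomicCharacter ℚ p h = 1 := by
  haveI : NeZero p := ⟨(Fact.out : p.Prime).ne_zero⟩
  intro hker
  -- every `σ` is `τ^{p-1}` times an element of `ker κ`
  have htriv : ∀ σ : absoluteGaloisGroup ℚ, modNCyclotomicCharacter ℚ p σ = 1 := by
    intro σ
    have hu : IsUnit ((p - 1 : ℕ) : ℤ_[p]) := by
      rw [PadicInt.isUnit_iff]
      rcases (PadicInt.norm_le_one ((p - 1 : ℕ) : ℤ_[p])).eq_or_lt with h | h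
      · exact h
      · exfalso
        rw [← Int.cast_natCast, PadicInt.norm_int_lt_one_iff_dvd] at h
        have h2 := (Fact.out : p.Prime).two_le
        have h' : (p : ℤ) ∣ (p - 1 : ℕ) := h
        have := Int.le_of_dvd (by omega) h'
        omega
    set x : ℤ_[p] := (κ σ).toAdd * ↑hu.unit⁻¹ with hx
    obtain ⟨τ, hτ⟩ := κ.surjective (Multiplicative.ofAdd x)
    have hτ' : κ τ = Multiplicative.ofAdd x := hτ
    have hmem : σ * (τ ^ (p - 1))⁻¹ ∈ κ.kerSubgroup := by
      rw [ZpExtension.mem_kerSubgroup, map_mul, map_inv, map_pow, hτ', ← ofAdd_nsmul, nsmul_eq_mul,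
        hx, ← mul_assoc, mul_comm ((p - 1 : ℕ) : ℤ_[p]), mul_assoc, IsUnit.mul_val_inv, mul_one,
        ofAdd_toAdd, mul_inv_cancel]
    have h1 := hker _ hmem
    rw [map_mul, map_inv, map_pow, ZMod.units_pow_card_sub_one_eq_one, inv_one, mul_one] at h1
    exact h1
  obtain ⟨σ, hσ⟩ := modNCyclotomicCharacter_rat_surjective p (-1)
  rw [htriv σ] at hσ
  haveI : Fact (2 < p) := ⟨lt_of_le_of_ne (Fact.out : p.Prime).two_le (Ne.symm hp2)⟩
  have h2 := congrArg (fun u : (ZMod p)ˣ ↦ (u : ZMod p)) hσ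
  simp only [Units.val_one, Units.val_neg] at h2
  exact ZMod.neg_one_ne_one h2.symm

/-- **An element of `ℚ̄` with `γ^p ∈ ℚˣ` fixed by `G_{ℚ_∞}` is rational** (`κ` any `ℤ_p`-extension
of `ℚ`, `p` odd). For `σ ∈ Γ_ℚ`, `σγ = ζ^iγ` and `ζ^i = σγ/γ` is fixed by the normal subgroup
`ker κ`; if `p ∤ i`, `χ_p` would vanish on `ker κ` (`not_kerSubgroup_le_ker_cyclotomic`); so every
`σ` fixes `γ` and `γ ∈ ℚ` (the fixed field of `Γ_ℚ`). [folklore] -/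
theorem exists_ratCast_eq_of_fixed [NeZero ((p : ℕ) : ℚ)] (hp2 : p ≠ 2) (κ : ZpExtension ℚ p)
    {ζ : AlgebraicClosure ℚ} (hζ : IsPrimitiveRoot ζ p) {a : ℚ} (ha : a ≠ 0)
    {γ : AlgebraicClosure ℚ} (hγ : γ ^ p = (a : AlgebraicClosure ℚ))
    (hfix : ∀ h ∈ κ.kerSubgroup, h • γ = γ) : ∃ r : ℚ, (r : AlgebraicClosure ℚ) = γ := by
  haveI : NeZero p := ⟨hp.out.ne_zero⟩
  have hγ0 : γ ≠ 0 := by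
    rintro rfl
    rw [zero_pow hp.out.ne_zero, eq_comm, Rat.cast_eq_zero] at hγ
    exact ha hγ
  have hall : ∀ σ : absoluteGaloisGroup ℚ, σ • γ = γ := by
    intro σ
    obtain ⟨i, hi, hσ⟩ := exists_smul_eq_pow_mul hζ ha hγ σ
    -- `ζ^i` is fixed by `ker κ`
    have hfixζ : ∀ h ∈ κ.kerSubgroup, h • ζ ^ i = ζ ^ i := by
      intro h hh
      have hh' : σ⁻¹ * h * σ ∈ κ.kerSubgroup := conj_mem_of_normal κ.kerSubgroup σ ⟨h, hh⟩
      have e1 : h • (σ • γ) = σ • γ := by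
        have := hfix _ hh'
        rw [mul_smul, mul_smul, inv_smul_eq_iff] at this
        exact this
      rw [hσ, smul_mul', hfix h hh] at e1
      exact mul_right_cancel₀ hγ0 e1
    by_cases hpi : p ∣ i
    · rw [hσ, (hζ.pow_eq_one_iff_dvd i).mpr hpi, one_mul]
    · exfalso
      refine not_kerSubgroup_le_ker_cyclotomic hp2 κ fun h hh ↦ ?_
      have hζi : IsPrimitiveRoot (ζ ^ i) p := hζ.pow_of_coprime i
        ((Nat.coprime_comm).mp ((Nat.Prime.coprime_iff_not_dvd hp.out).mpr hpi))
      ext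
      rw [Units.val_one, ← Nat.cast_one]
      exact modNCyclotomicCharacter_eq_of_smul_eq_pow ℚ p hζi h (by rw [pow_one]; exact hfixζ h hh)
  obtain ⟨m, r, hr⟩ :=
    absoluteGaloisGroup.exists_algebraMap_eq_pow_of_forall_smul_eq ℚ 1 (x := γ) hall
  refine ⟨r, ?_⟩
  rw [one_pow, pow_one] at hr
  rw [← hr]
  rfl

end Injective

end KummerLineClasses

end Summit.BirchSwinnertonDyer.Rank1Residual.Additive
end
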